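import Mathlib
import HarnessLib
import Summits.CriticalPhenomena.Ising3DConformalLimit.Theorems.LatticeSDPCertificatesWindowGivesTopHeavyBubble
import Literature.Probability.LatticeModels.PointwiseScalingLimitEtaExists
import Literature.Probability.LatticeModels.CriticalEtaUpperDCPProofs
import Literature.Probability.LatticeModels.FKIsingRSWTwoPoint

/-!
# WINDOW ⇒ θ-weighted top-heavy bubble (line backbone-thinning-window, stub `stub_thetaBubble`)

Write `G = ⟨σ₀σ_x⟩⁺_{β_c(3)} = criticalTwoPoint 3` and `a_n = G(n e₁)`. WINDOW is the hypothesis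
`c (n/m)^{-(3/2-ε)} a_m ≤ a_n` for all `1 ≤ m ≤ n`. For `0 ≤ θ < ε` we prove the θ-weighted
top-heavy bubble bound
`Σ_{0 ≠ w ∈ Λ_R} ‖w‖^{-2θ} G(w)² ≤ C_b R^{3-2θ} a_R²` for all `R ≥ 1` (`‖·‖` the sup norm).

Proof. Shrink `ε` to `ε' = min ε (θ + ½)` (WINDOW is monotone in `ε` since `n/m ≥ 1`), so that
`0 < 2(ε'-θ) ≤ 1`. For `w ≠ 0` with `‖w‖_∞ ≤ R`, the pointwise step of the `θ = 0` case
(`criticalTwoPoint_sq_le_of_window`: MMS sandwich + WINDOW between the scales `‖w‖_∞ ≤ R`) gives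
`G(w)² ≤ c⁻² R^{3-2ε'} ‖w‖^{-(3-2ε')} a_R²`, hence
`‖w‖^{-2θ} G(w)² ≤ c⁻² R^{3-2ε'} ‖w‖^{-(3-2ε'+2θ)} a_R²`. Summing over shells
(`sum_box_erase_norm_rpow_le`) and `Σ_{m<R} (m+1)^{2(ε'-θ)-1} ≤ R^{2(ε'-θ)}/(2(ε'-θ))`
(`sum_range_rpow_sub_one_le`) gives the claim with `C_b = 54 / (c² · 2(ε'-θ))`.

References: Messager–Miracle-Solé (J. Stat. Phys. 1977) for the sandwich; the counting is that of
Duminil-Copin–Panis 2025, proof of Thm 1.5. No definitions are introduced.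
-/

namespace Summit.CriticalPhenomena.Ising3DConformalLimit.LatticeSDPCertificatesWindowForcesU4.ThetaBubbleProof

open Literature.Probability.LatticeModels Finset
open Summit.CriticalPhenomena.Ising3DConformalLimit.Theorems

/-- **WINDOW ⇒ θ-weighted top-heavy bubble.** If `c (n/m)^{-(3/2-ε)} ⟨σ₀σ_{me₁}⟩ ≤ ⟨σ₀σ_{ne₁}⟩`
for all `1 ≤ m ≤ n` at `β_c(3)` and `0 ≤ θ < ε`, then
`Σ_{0 ≠ w ∈ Λ_R} ‖w‖^{-2θ} ⟨σ₀σ_w⟩² ≤ C_b R^{3-2θ} ⟨σ₀σ_{Re₁}⟩²` for all `R ≥ 1`, with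
`C_b = 54 / (c² · 2(ε'-θ))`, `ε' = min ε (θ + ½)`. [folklore] -/
theorem stub_thetaBubble :
    ∀ θ ε cW : ℝ, 0 ≤ θ → θ < ε → 0 < cW →
      (∀ m n : ℕ, 1 ≤ m → m ≤ n → cW * ((n : ℝ) / m) ^ (-((3:ℝ) / 2 - ε)) * criticalTwoPoint 3 (Pi.single 0 (m : ℤ)) ≤ criticalTwoPoint 3 (Pi.single 0 (n : ℤ))) →
      ∃ Cb : ℝ, 0 < Cb ∧ ∀ R : ℕ, 1 ≤ R →
        ∑ w ∈ (box 3 R).erase 0, ‖w‖ ^ (-(2 * θ)) * criticalTwoPoint 3 w ^ 2 ≤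
          Cb * (R : ℝ) ^ (3 - 2 * θ) * criticalTwoPoint 3 (Pi.single 0 (R : ℤ)) ^ 2 := by
  intro θ ε₀ c _hθ hθε₀ hc hwin₀
  -- shrink the exponent gain to `ε = min ε₀ (θ + 1/2)`
  obtain ⟨ε, hθε, hε1, hwin⟩ : ∃ ε : ℝ, θ < ε ∧ ε ≤ θ + 1 / 2 ∧ ∀ m n : ℕ, 1 ≤ m → m ≤ n →
      c * ((n : ℝ) / m) ^ (-((3:ℝ) / 2 - ε)) * criticalTwoPoint 3 (Pi.single 0 (m : ℤ)) ≤
        criticalTwoPoint 3 (Pi.single 0 (n : ℤ)) := by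
    refine ⟨min ε₀ (θ + 1 / 2), lt_min hθε₀ (by linarith), min_le_right _ _,
      fun m n hm hmn => ?_⟩
    refine le_trans ?_ (hwin₀ m n hm hmn)
    have hmpos : (0:ℝ) < m := by exact_mod_cast hm
    have hx1 : (1:ℝ) ≤ (n:ℝ) / m := by
      rw [le_div_iff₀ hmpos, one_mul]
      exact_mod_cast hmn
    have hexp : -((3:ℝ) / 2 - min ε₀ (θ + 1 / 2)) ≤ -((3:ℝ) / 2 - ε₀) := by
      have := min_le_left ε₀ (θ + 1 / 2)
      linarith
    exact mul_le_mul_of_nonneg_right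
      (mul_le_mul_of_nonneg_left (Real.rpow_le_rpow_of_exponent_le hx1 hexp) hc.le)
      (criticalTwoPoint_nonneg' _)
  -- the summation exponent `p = 2(ε - θ) ∈ (0, 1]`, kept atomic
  obtain ⟨p, hp, hp0, hp1⟩ : ∃ p : ℝ, p = 2 * (ε - θ) ∧ 0 < p ∧ p ≤ 1 :=
    ⟨_, rfl, by linarith, by linarith⟩
  refine ⟨54 / (c ^ 2 * p), by positivity, fun R hR => ?_⟩
  have hRpos : (0:ℝ) < R := by exact_mod_cast hR
  -- pointwise bound for `w ≠ 0`
  have hpt : ∀ w ∈ (box 3 R).erase 0, ‖w‖ ^ (-(2 * θ)) * criticalTwoPoint 3 w ^ 2 ≤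
      criticalTwoPoint 3 (Pi.single 0 (R : ℤ)) ^ 2 * (R:ℝ) ^ ((3:ℝ) - 2 * ε) / c ^ 2 *
        ‖w‖ ^ (-((3:ℝ) - 2 * ε + 2 * θ)) := by
    intro w hw
    have hw0 : w ≠ 0 := Finset.ne_of_mem_erase hw
    have hnpos : 0 < ‖w‖ := norm_pos_iff.2 hw0
    have h1 := criticalTwoPoint_sq_le_of_window hc hwin hw0 (Finset.mem_of_mem_erase hw)
    have hθnn : 0 ≤ ‖w‖ ^ (-(2 * θ)) := Real.rpow_nonneg hnpos.le _
    calc ‖w‖ ^ (-(2 * θ)) * criticalTwoPoint 3 w ^ 2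
        ≤ ‖w‖ ^ (-(2 * θ)) *
            (criticalTwoPoint 3 (Pi.single 0 (R : ℤ)) ^ 2 * (R:ℝ) ^ ((3:ℝ) - 2 * ε) / c ^ 2 *
              ‖w‖ ^ (-((3:ℝ) - 2 * ε))) := mul_le_mul_of_nonneg_left h1 hθnn
      _ = criticalTwoPoint 3 (Pi.single 0 (R : ℤ)) ^ 2 * (R:ℝ) ^ ((3:ℝ) - 2 * ε) / c ^ 2 *
            (‖w‖ ^ (-(2 * θ)) * ‖w‖ ^ (-((3:ℝ) - 2 * ε))) := by ring
      _ = criticalTwoPoint 3 (Pi.single 0 (R : ℤ)) ^ 2 * (R:ℝ) ^ ((3:ℝ) - 2 * ε) / c ^ 2 *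
            ‖w‖ ^ (-((3:ℝ) - 2 * ε + 2 * θ)) := by
          rw [← Real.rpow_add hnpos,
            show -(2 * θ) + -((3:ℝ) - 2 * ε) = -((3:ℝ) - 2 * ε + 2 * θ) by ring]
  have hK : 0 ≤ criticalTwoPoint 3 (Pi.single 0 (R : ℤ)) ^ 2 * (R:ℝ) ^ ((3:ℝ) - 2 * ε) / c ^ 2 := by
    positivity
  have h3 : (R:ℝ) ^ ((3:ℝ) - 2 * ε) * (R:ℝ) ^ p = (R:ℝ) ^ ((3:ℝ) - 2 * θ) := by
    rw [← Real.rpow_add hRpos, hp, show (3:ℝ) - 2 * ε + 2 * (ε - θ) = 3 - 2 * θ by ring]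
  calc ∑ w ∈ (box 3 R).erase 0, ‖w‖ ^ (-(2 * θ)) * criticalTwoPoint 3 w ^ 2
      ≤ ∑ w ∈ (box 3 R).erase 0,
          criticalTwoPoint 3 (Pi.single 0 (R : ℤ)) ^ 2 * (R:ℝ) ^ ((3:ℝ) - 2 * ε) / c ^ 2 *
            ‖w‖ ^ (-((3:ℝ) - 2 * ε + 2 * θ)) := Finset.sum_le_sum hpt
    _ = criticalTwoPoint 3 (Pi.single 0 (R : ℤ)) ^ 2 * (R:ℝ) ^ ((3:ℝ) - 2 * ε) / c ^ 2 *
          ∑ w ∈ (box 3 R).erase 0, ‖w‖ ^ (-((3:ℝ) - 2 * ε + 2 * θ)) := by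
        rw [Finset.mul_sum]
    _ ≤ criticalTwoPoint 3 (Pi.single 0 (R : ℤ)) ^ 2 * (R:ℝ) ^ ((3:ℝ) - 2 * ε) / c ^ 2 *
          (54 * ∑ m ∈ Finset.range R, ((m:ℝ) + 1) ^ (2 - ((3:ℝ) - 2 * ε + 2 * θ))) :=
        mul_le_mul_of_nonneg_left (sum_box_erase_norm_rpow_le _ R) hK
    _ ≤ criticalTwoPoint 3 (Pi.single 0 (R : ℤ)) ^ 2 * (R:ℝ) ^ ((3:ℝ) - 2 * ε) / c ^ 2 *
          (54 * ((R:ℝ) ^ p / p)) := by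
        refine mul_le_mul_of_nonneg_left (mul_le_mul_of_nonneg_left ?_ (by norm_num)) hK
        rw [show (2:ℝ) - (3 - 2 * ε + 2 * θ) = p - 1 by rw [hp]; ring]
        exact sum_range_rpow_sub_one_le hp0 hp1 R
    _ = 54 / (c ^ 2 * p) * ((R:ℝ) ^ ((3:ℝ) - 2 * ε) * (R:ℝ) ^ p) *
          criticalTwoPoint 3 (Pi.single 0 (R : ℤ)) ^ 2 := by
        ring
    _ = 54 / (c ^ 2 * p) * (R:ℝ) ^ ((3:ℝ) - 2 * θ) *
          criticalTwoPoint 3 (Pi.single 0 (R : ℤ)) ^ 2 := by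
        rw [h3]

end Summit.CriticalPhenomena.Ising3DConformalLimit.LatticeSDPCertificatesWindowForcesU4.ThetaBubbleProof
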